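import Literature.MathematicalPhysics.QuantumFieldTheory.Balaban1983to89.Node00.Record13CarriersXPinnedP2DSViewCoPH

/-!
# BalabanUVNodes ∕ N05 ([B8], `Dag.B8_main`) AT THE K1 ENGINE'S X-PINNED VIEW — PRINT'S BACKGROUND (v1.7 key `SepCoPH`), «P₂D» PIN (δ₂ group over the (1.5)-OBEYING
# admissible sub-index `IdxB8SubD`, Proposition 7 in the repaired currency with print's tower map PINNED), SC-BINDING: THE SLOT CLOSERS at the four-pin X-P₂D record
# `Node00.IsRecordOfRecord₁₃CSepCoPHSX3P₂DV` (`Node00/Record13CarriersXPinnedP2DSViewCoPH`, this seat: [B8] on the «P₂D» slot at the layer `lam8`, [B12] ∕ [B13] at ANY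
# `lam12 lam13`, B10 ∕ Y ∕ Z ∕ W pins at ANY `Mstar ops ζ lamW` — the engine's world shape) in slot-currency AND in ∃λ-currency (+ the same-datum `₁₃CSepCoPH` companion
# at the C-bound view)

Track A of `YM-PLAN.md` (cell `pub-ymgap`, HUMAN RULING D-0062 ∕ D-0149 width seats), node **N05** = [Balaban1985RegularSpaces] Lemma 1, Thm 2, Prop 3, Thm 4, Props 5–7,
Thm 8; width seat `pub-ymgap-dag-n05-w4` (g3), 2026-08-28, key item K1⁸ `StabilityBRunRowsAtRecordR13SepCoPH` (dag-lead KEY MAP v1.65; `--supports`, helper; count-neutral).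
«P₂D» TWIN (token map «`SX3P₂CV ↦ SX3P₂DV`, `pinX3P₂C ↦ pinX3P₂D`, `B8LeafOfRecordSubBP₂C ↦ B8LeafOfRecordSubBP₂D`; SC-binding `upOfRecord₅CSC … (c₇OfRecord θ₃)` UNCHANGED»)
of this seat's `Thm/BalabanUVNodesN05AtXPinnedP2CSViewSepCoPH` (p613878), on this seat's X-P₂D view record `Node00/Record13CarriersXPinnedP2DSViewCoPH` over dag-n05-w1's pin
`Node00/CarriersB8SubBP2D` (p617069; dag-n05-d g12 DESIGN WORD «P₂D», cell bus 2026-08-28 07:54Z: the slot's index shrinks to the (1.5)-obeying members `IdxB8SubD` because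
the «P₂C» knits' [4]-letters binders are unsatisfiable as typed — dag-n05-w1's certificate `B8SockLettersRDIdxB8LawsBVacuity` p613168, repair letter dag-n05-c's `LamTop` p613464).

* §1 `exists_isRecordOfRecord₁₃CSepCoPHSX3P₂DV_b8_of_leaf` — THE SLOT CLOSER AT THE ENGINE'S VIEW: admissible `θ` with v1.7 provisos `h`, ANY `lam12 lam13 Mstar ops ζ lamW`, a [B8]
  layer `λ` and a proof of the «P₂D» slot `B8LeafOfRecordSubBP₂D θ.toStage3Params λ` ⇒ for every `γw ∈ ]0, θ.γ]`, worlds `w w′`: `IsRecordOfRecord₁₃CSepCoPHSX3P₂DV F N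
  (datumOfRecord₁₃SepCoPH θ h) w` with its SC-binding DISPLAYED at `(θ.pinX3P₂D λ lam12 lam13).view₁₃CoPHB10YZW Mstar ops ζ lamW`, EVERY run's `b8` leaf and `Dag.B8_main`, and the
  same-datum companion (leaves equal off `b8`); `b8_main_at_…_of_forall_leaf` (∀-currency).
* §2 `exists_isRecordOfRecord₁₃CSepCoPHSX3P₂DV_b8_of_exists_leaf` — THE SAME IN ∃λ-CURRENCY: from `∃ λ, B8LeafOfRecordSubBP₂D θ.toStage3Params λ` (the N05 row TYPE of
  a four-pin engine in its P₂D edition, «`h05 ↦ ∃ lam8, B8LeafOfRecordSubBP₂D θ₃ lam8`», and the CONCLUSION SHAPE of dag-n05-d g12's re-keyed ∃λ theorem (11)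
  `…SubBP2DSlotExistsLawLanGammaPrime.exists_residB8_b8LeafOfRecordSubBP₂D_lawLan_of_lettersSrc_γ'` (announced, INTENT-11)) ⇒ `∃ λ w w′` as in §1 — the by-name adapter any
  ∃λ supplier plugs into; `exists_record_b8_main_of_exists_leaf` (world-level reading).  NO socket ∕ letters text is displayed here.
DEFERRED (declared): the knit-fed ∕ sockets-fed displays at this view (dag-n05-d's re-keyed «P₂D» knits (6)–(9) ∕ slot (10) ∕ ∃λ theorem (11)) — they display the five
(1.5)-keyed [4]-type families (N06 content, m ≥ 1 OPEN); an image keyed on (11) follows in a sibling file once (11) lands; this file carries NO such display.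

HONEST FRAMING: kernel bookkeeping by name; NO estimate; nothing of [Balaban1985RegularSpaces] asserted — the «P₂D» slot (§1) ∕ its ∃λ form (§2) is a HYPOTHESIS; Proposition 7
inside the slot in the repaired currency `c₇OfRecord θ₃ = 530·D·L²` (WEAKER than print's `2α₂`, declared by the pin, WATCH-P7-CURRENCY-RECORD); count-neutral; **N05 NOT
discharged**; K1 NOT claimed (whether an engine edition re-targets to `X' := XPinned₁₃P₂D` with the SC-binding is dag-n24's ∕ the plan's word); no count claim; Bałaban AS
PRINTED with locators; one finite 𝕋⁴ programme at fixed ε — the Yang–Mills mass gap (Clay) is NOT proved by any of this; R4 closes the conditional finite-𝕋⁴ rung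
`BalabanLadder.UV` only; nothing continuum ∕ ℝ⁴ ∕ OS.  No `sorry`, no new definition, no `instance`, no `notation`.  Unit `pub-ymgap-dag-n05-w4` (g3), 2026-08-28.
[cite: Balaban1985RegularSpaces, Lemma 1 p.79, Thm 2 p.83, Prop. 3 p.87, Thm 4 p.88, Prop. 5 (1.107)–(1.109) p.94, Prop. 6 (1.131)–(1.138) pp.98–99, Prop. 7 (1.144)–(1.145) p.100, Thm 8 (1.146) p.101; Balaban1989LargeFieldII, Thm 1 + (0.1) pp.355–356 (the record, bookkeeping)]
-/

noncomputable section

namespace Summit.QuantumFields.YangMills.BalabanUVNodes.N05AtXPinnedP2DSViewSepCoPH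

open Literature.MathematicalPhysics.QuantumFieldTheory.Balaban1983to89
open Literature.MathematicalPhysics.QuantumFieldTheory.Balaban1983to89.Node00
open Literature.MathematicalPhysics.QuantumFieldTheory.Balaban1983to89.T4Continuum
open Literature.MathematicalPhysics.QuantumFieldTheory.Balaban1983to89.DagBinding
open scoped Matrix.Norms.L2Operator

/-! ## §1. The slot closer at the SC-bound four-pin X-P₂D v1.7 record (any proof of the «P₂D» slot ⇒ N05 in ∃-currency at the engine's view + companion) -/

section Slot

variable {F : T4Family} {N : ℕ} [NeZero N]

/-- **THE SLOT CLOSER AT THE RECORD OF RECORD (v1.7 key, «P₂D» pin, SC-binding).**  ADMISSIBLE Stage-13 H-parameters `θ` WITH the v1.7 provisos `h`, a residual [B8] layer `lam`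
and a proof of the «P₂D» slot `B8LeafOfRecordSubBP₂D θ.toStage3Params lam` give, for every window `γw ∈ ]0, θ.γ]`, worlds `w w′` with: `IsRecordOfRecord₁₃CSepCoPHSX3P₂DV F N
(datumOfRecord₁₃SepCoPH θ h) w` (binding DISPLAYED: the SC-binding `upOfRecord₅CSC … (c₇OfRecord θ₃)` over the four-pin v1.7 view of the X-P₂D-pinned parameter), EVERY run's `b8` leaf and `Dag.B8_main`, and the same-datum companion
`IsRecordOfRecord₁₃CSepCoPH … w′` (leaves equal off `b8`).  Pure bookkeeping over `Node00/Record13CarriersXPinnedP2DSViewCoPH`.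
[cite: Balaban1985RegularSpaces, Lemma 1 – Thm 8 pp.79–101, Thm 8 (1.146) p.101 (the slot); Balaban1989LargeFieldII, Thm 1 + (0.1) pp.355–356 (the record, bookkeeping)] -/
theorem exists_isRecordOfRecord₁₃CSepCoPHSX3P₂DV_b8_of_leaf (θ : Stage13HParams F N) (h : θ.Provisos₁₃SepCoPH F N) (hθ : θ.Admissible F N)
    (lam12 : ResidB12 F N θ.τ9.M) (lam13 : B12.RunParams → ResidB13 θ.toStage3Params) (Mstar : ℕ) (ops : OpsY N θ.toStage3Params Mstar)
    (ζ : ResidZ F N) (lamW : ResidW F N)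
    (lam : ResidB8 θ.toStage3Params) (hleaf : B8LeafOfRecordSubBP₂D θ.toStage3Params lam) {γw : ℝ} (hγ0 : 0 < γw) (hγ1 : γw ≤ θ.γ) :
    ∃ w w' : WorldP, IsRecordOfRecord₁₃CSepCoPHSX3P₂DV F N (datumOfRecord₁₃SepCoPH F N θ h) w ∧
      w.C = (datumOfRecord₁₃SepCoPH F N θ h).C ∧ w.γ = γw ∧ w.L = (θ.L : ℝ) ∧
      (∀ P : B12.RunParams, w.up P = upOfRecord₅CSC F N ((θ.pinX3P₂D F N lam lam12 lam13).view₁₃CoPHB10YZW F N Mstar ops ζ lamW) (c₇OfRecord θ.toStage3Params) P) ∧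
      (∀ P : B12.RunParams, (leavesP w P).b8 ∧ Dag.B8_main (leavesP w P)) ∧
      IsRecordOfRecord₁₃CSepCoPH F N (datumOfRecord₁₃SepCoPH F N θ h) w' ∧ w'.C = w.C ∧ w'.γ = w.γ ∧ w'.L = w.L ∧
      ∀ P : B12.RunParams, leavesP w P = { leavesP w' P with b8 := (leavesP w P).b8 } := by
  obtain ⟨w₀, -, -⟩ := exists_world_isRecordOfRecord₁₃CSepCoPH F N θ h hθ ⟨hγ0, hγ1⟩
  have hrec : IsRecordOfRecord₁₃CSepCoPHSX3P₂DV F N (datumOfRecord₁₃SepCoPH F N θ h)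
      { w₀ with
        C := (datumOfRecord₁₃SepCoPH F N θ h).C, γ := γw, L := (θ.L : ℝ), one_lt_L := by exact_mod_cast θ.hL.2,
        up := fun P => upOfRecord₅CSC F N ((θ.pinX3P₂D F N lam lam12 lam13).view₁₃CoPHB10YZW F N Mstar ops ζ lamW) (c₇OfRecord θ.toStage3Params) P } :=
    ⟨θ, h, lam, lam12, lam13, Mstar, ops, ζ, lamW, hθ, rfl, rfl, ⟨hγ0, hγ1⟩, rfl, fun _ => rfl⟩
  obtain ⟨w', hw', hC', hγ', hL', hleaves, -⟩ := companion_of_isRecordOfRecord₁₃CSepCoPHSX3P₂DV hrec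
  refine ⟨_, w', hrec, rfl, rfl, rfl, fun _ => rfl, fun P => ?_, hw', hC', hγ', hL', hleaves⟩
  have hb8 : (upOfRecord₅CSC F N ((θ.pinX3P₂D F N lam lam12 lam13).view₁₃CoPHB10YZW F N Mstar ops ζ lamW) (c₇OfRecord θ.toStage3Params) P).b8 :=
    (socket05SC_view₁₃CoPHB10YZW_pinX3P₂D_iff F N θ lam lam12 lam13 Mstar ops ζ lamW P).2 hleaf
  obtain ⟨h8iff, -, -⟩ := b8_b11_b10_main_iff_of_isRecordOfRecord₁₃CSepCoPHSX3P₂DV hrec P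
  exact ⟨hb8, h8iff.2 fun _ => hb8⟩

/-- **THE SLOT CLOSER, ∀-CURRENCY OVER THE MODULE'S RECORDS**: if the «P₂D» slot holds at EVERY admissible v1.7 package, `Dag.B8_main` holds at every run of every record of
`IsRecordOfRecord₁₃CSepCoPHSX3P₂DV` (instance of `b8_main_of_isRecordOfRecord₁₃CSepCoPHSX3P₂DV_of_slot`). [cite: Balaban1985RegularSpaces, Thm 8 (1.146) p.101 (bookkeeping)] -/
theorem b8_main_at_isRecordOfRecord₁₃CSepCoPHSX3P₂DV_of_forall_leaf
    (hB : ∀ (θ : Stage13HParams F N), θ.Provisos₁₃SepCoPH F N → θ.Admissible F N → ∀ lam : ResidB8 θ.toStage3Params, B8LeafOfRecordSubBP₂D θ.toStage3Params lam)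
    {D : FiniteEpsData F (SU N)} {w : WorldP} (h : IsRecordOfRecord₁₃CSepCoPHSX3P₂DV F N D w) (P : B12.RunParams) : Dag.B8_main (leavesP w P) :=
  b8_main_of_isRecordOfRecord₁₃CSepCoPHSX3P₂DV_of_slot h (fun θ hP lam _ _ _ _ _ _ hθ _ _ => hB θ hP hθ lam) P

end Slot

/-! ## §2. The slot closer in ∃λ-currency (the engine row type «∃ λ, slot» ⇒ N05 in ∃-currency at the engine's view + companion) -/

section ExistsSlot

variable {F : T4Family} {N : ℕ} [NeZero N]

/-- **THE SLOT CLOSER IN ∃λ-CURRENCY** (the N05 row type of the four-pin engine in its P₂D edition, «`∃ lam8, B8LeafOfRecordSubBP₂D θ₃ lam8`», = the conclusion shape of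
dag-n05-d's ∃λ theorems): admissible `θ` with v1.7 provisos, ANY `lam12 lam13 Mstar ops ζ lamW`, and `∃ λ, B8LeafOfRecordSubBP₂D θ.toStage3Params λ` give, for every window
`γw ∈ ]0, θ.γ]`, `∃ λ w w′` exactly as in §1.  One `obtain` + §1.  The ∃λ hypothesis is a HYPOTHESIS (whichever supplier feeds it displays its own sockets); N05 NOT discharged.
[cite: Balaban1985RegularSpaces, Thm 8 (1.146) p.101 (the slot); Balaban1989LargeFieldII, Thm 1 + (0.1) pp.355–356 (the record, bookkeeping)] -/
theorem exists_isRecordOfRecord₁₃CSepCoPHSX3P₂DV_b8_of_exists_leaf (θ : Stage13HParams F N) (h : θ.Provisos₁₃SepCoPH F N) (hθ : θ.Admissible F N)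
    (lam12 : ResidB12 F N θ.τ9.M) (lam13 : B12.RunParams → ResidB13 θ.toStage3Params) (Mstar : ℕ) (ops : OpsY N θ.toStage3Params Mstar)
    (ζ : ResidZ F N) (lamW : ResidW F N)
    (hslot : ∃ lam : ResidB8 θ.toStage3Params, B8LeafOfRecordSubBP₂D θ.toStage3Params lam) {γw : ℝ} (hγ0 : 0 < γw) (hγ1 : γw ≤ θ.γ) :
    ∃ (lam : ResidB8 θ.toStage3Params) (w w' : WorldP), IsRecordOfRecord₁₃CSepCoPHSX3P₂DV F N (datumOfRecord₁₃SepCoPH F N θ h) w ∧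
      w.C = (datumOfRecord₁₃SepCoPH F N θ h).C ∧ w.γ = γw ∧ w.L = (θ.L : ℝ) ∧
      (∀ P : B12.RunParams, w.up P = upOfRecord₅CSC F N ((θ.pinX3P₂D F N lam lam12 lam13).view₁₃CoPHB10YZW F N Mstar ops ζ lamW) (c₇OfRecord θ.toStage3Params) P) ∧
      (∀ P : B12.RunParams, (leavesP w P).b8 ∧ Dag.B8_main (leavesP w P)) ∧
      IsRecordOfRecord₁₃CSepCoPH F N (datumOfRecord₁₃SepCoPH F N θ h) w' ∧ w'.C = w.C ∧ w'.γ = w.γ ∧ w'.L = w.L ∧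
      ∀ P : B12.RunParams, leavesP w P = { leavesP w' P with b8 := (leavesP w P).b8 } := by
  obtain ⟨lam, hleaf⟩ := hslot
  exact ⟨lam, exists_isRecordOfRecord₁₃CSepCoPHSX3P₂DV_b8_of_leaf θ h hθ lam12 lam13 Mstar ops ζ lamW lam hleaf hγ0 hγ1⟩

/-- **N05 AT SOME RECORD OF THE MODULE, ∃λ-currency, world-level reading**: under the same hypotheses there is a record `w` of `IsRecordOfRecord₁₃CSepCoPHSX3P₂DV` at `θ`'s
datum, window `γw`, with `Dag.B8_main (leavesP w P)` at every run (§2 with the binding and the companion forgotten). [cite: Balaban1985RegularSpaces, Thm 8 (1.146) p.101 (bookkeeping)] -/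
theorem exists_record_b8_main_of_exists_leaf (θ : Stage13HParams F N) (h : θ.Provisos₁₃SepCoPH F N) (hθ : θ.Admissible F N)
    (lam12 : ResidB12 F N θ.τ9.M) (lam13 : B12.RunParams → ResidB13 θ.toStage3Params) (Mstar : ℕ) (ops : OpsY N θ.toStage3Params Mstar)
    (ζ : ResidZ F N) (lamW : ResidW F N)
    (hslot : ∃ lam : ResidB8 θ.toStage3Params, B8LeafOfRecordSubBP₂D θ.toStage3Params lam) {γw : ℝ} (hγ0 : 0 < γw) (hγ1 : γw ≤ θ.γ) :
    ∃ w : WorldP, IsRecordOfRecord₁₃CSepCoPHSX3P₂DV F N (datumOfRecord₁₃SepCoPH F N θ h) w ∧ w.γ = γw ∧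
      ∀ P : B12.RunParams, (leavesP w P).b8 ∧ Dag.B8_main (leavesP w P) := by
  obtain ⟨_, w, _, hw, -, hγ, -, -, hmain, -⟩ :=
    exists_isRecordOfRecord₁₃CSepCoPHSX3P₂DV_b8_of_exists_leaf θ h hθ lam12 lam13 Mstar ops ζ lamW hslot hγ0 hγ1
  exact ⟨w, hw, hγ, hmain⟩

end ExistsSlot

end Summit.QuantumFields.YangMills.BalabanUVNodes.N05AtXPinnedP2DSViewSepCoPH

end
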